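import Mathlib
import Literature.Combinatorics.Additive.RestrictedSumsetsInRootsOfUnityBound

/-!
# Restricted sumsets in the roots of unity: Yip's bound with `0 ∈ A` (even size, no loss)

Companion of `RestrictedSumsetsInRootsOfUnityBound` (C. H. Yip, *Restricted sumsets in multiplicative subgroups*,
Canad. J. Math. 2025, arXiv:2309.10950, Prop. 3.1).  The "moreover" clause of Prop. 3.1: when `0 ∈ A`, every other
point `a` of the restricted clique satisfies `a ^ d = (0 + a)^d = 1`, and the auxiliary polynomial of `A ∖ {0}`
vanishes at `0` to the FULL order `|A ∖ {0}| = 2m + 1` (`X_pow_dvd_stepanovPoly`); so for `|A|` even one gets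
`|A|(|A|−1)/2 + #{a ∈ A ∖ {0} : 2a ∈ S ∪ {0}} ≤ d`, the odd-size bound with no loss
(`choose_two_add_card_good_le_of_restrictedSumset_subset_rootsOfUnity_of_zero_mem`)
[cite: Yip2025, Prop. 3.1, last display of the proof].

Use on the crux side (`Summits/ValiantsHypothesis/…/Theorems/FeketeSOSCharPSparseSOSSumCliqueStepanov.lean`): an
ANTI-DIAGONAL restricted Paley sum-clique `T ⊂ 𝔽_p` (all `2a` non-residues) with `(2|p) = −1` lies inside the
quadratic residues, so `T ∪ {0}` is again a restricted clique and `|T|(|T|+1) ≤ p − 1`: one notch below the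
weak-Sidon counting bound `|T|(|T|−1) ≤ p − 1`, with no Sidon hypothesis.
-/

namespace Literature.Combinatorics.Additive.Yip

open Polynomial Finset
open Literature.Combinatorics.Additive.HansonPetridis

section ZeroRefinement

variable {F : Type*} [Field F] [DecidableEq F]

/-- **Full-order vanishing at `0`** [cite: Yip2025, Prop. 3.1, proof (the case `0 ∈ A`)]: if every `a ∈ A` has
`a ^ d = 1` (and `|A| = 2m + 1`), then `X^{2m+1}` divides `f = Σ_a w_a (X + a)^{d+m} (X − a)^m − (−1)^m`: at `b = 0`
the weighted Taylor sums are `± Σ_a w_a a^{2m − (k+l)}`, which vanish for `1 ≤ k + l ≤ 2m`. -/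
theorem X_pow_dvd_stepanovPoly (A : Finset F) (d m : ℕ) (hm : 2 * m + 1 = A.card) (hA : ∀ a ∈ A, a ^ d = 1) :
    X ^ (2 * m + 1) ∣
      ((∑ a ∈ A, C (Lagrange.nodalWeight A id a) * ((X + C a) ^ (d + m) * (X - C a) ^ m)) - C ((-1 : F) ^ m)) := by
  rw [stepanovPoly_eq_sum A (d + m) m 0]
  refine Finset.dvd_sum fun k hk => Finset.dvd_sum fun l hl => ?_
  rw [mem_range] at hk hl
  rw [map_zero, sub_zero]
  by_cases hlow : k + l ≤ 2 * m
  · -- the weighted sum is `(−1)^{m−l} Σ_a w_a a^{2m−(k+l)} = [k = l = 0] (−1)^m`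
    have hterm : ∀ a ∈ A, Lagrange.nodalWeight A id a * ((a + 0) ^ (d + m - k) * (0 - a) ^ (m - l)) =
        (-1) ^ (m - l) * (Lagrange.nodalWeight A id a * a ^ (2 * m - (k + l))) := by
      intro a ha
      rw [add_zero, zero_sub, neg_pow]
      have h1 : a ^ (d + m - k) * a ^ (m - l) = a ^ (2 * m - (k + l)) := by
        rw [← pow_add, show d + m - k + (m - l) = d + (2 * m - (k + l)) by omega, pow_add, hA a ha, one_mul]
      rw [← h1]
      ring
    have hS : ∑ a ∈ A, Lagrange.nodalWeight A id a * ((a + 0) ^ (d + m - k) * (0 - a) ^ (m - l)) =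
        if k = 0 ∧ l = 0 then (-1) ^ m else 0 := by
      rw [Finset.sum_congr rfl hterm, ← Finset.mul_sum, sum_nodalWeight_mul_pow A _ (by omega)]
      by_cases h00 : k = 0 ∧ l = 0
      · obtain ⟨rfl, rfl⟩ := h00
        rw [if_pos (by omega), if_pos ⟨rfl, rfl⟩, mul_one, Nat.sub_zero]
      · rw [if_neg (by omega), mul_zero, if_neg h00]
    rw [hS]
    by_cases h00 : k = 0 ∧ l = 0
    · obtain ⟨rfl, rfl⟩ := h00
      rw [if_pos ⟨rfl, rfl⟩, if_pos ⟨rfl, rfl⟩, Nat.choose_zero_right, Nat.choose_zero_right, Nat.cast_one,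
        one_mul, one_mul, add_zero, pow_zero, mul_one, sub_self]
      exact dvd_zero _
    · rw [if_neg h00, if_neg h00, mul_zero, map_zero, zero_mul, sub_zero]
      exact dvd_zero _
  · have h00 : ¬ (k = 0 ∧ l = 0) := fun h => by
      obtain ⟨rfl, rfl⟩ := h
      omega
    rw [if_neg h00, sub_zero]
    exact Dvd.dvd.mul_left (pow_dvd_pow X (by omega)) _

/-- **Yip, Proposition 3.1, the `0 ∈ A` refinement** [cite: Yip2025, Prop. 3.1 ("Moreover, further assume that
`0 ∈ A` …")].  Let `A` be a finite subset of a field with `0 ∈ A` and `|A|` even, `d : ℕ`; suppose `(a + a')^d = 1` for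
all `a ≠ a'` in `A`, and that some `b₀ ∈ A` has `2b₀ ≠ 0`, `(2b₀)^d ≠ 1`.  Then
`|A|(|A| − 1)/2 + #{a ∈ A ∖ {0} : 2a = 0 ∨ (2a)^d = 1} ≤ d` (the auxiliary polynomial of `A ∖ {0}` vanishes at `0` to
order `|A| − 1`). -/
theorem choose_two_add_card_good_le_of_restrictedSumset_subset_rootsOfUnity_of_zero_mem (d : ℕ) (A : Finset F)
    (hA : ∀ a ∈ A, ∀ a' ∈ A, a ≠ a' → (a + a') ^ d = 1) (h0 : (0 : F) ∈ A) (heven : Even A.card)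
    (hbad : ∃ b₀ ∈ A, 2 * b₀ ≠ 0 ∧ (2 * b₀) ^ d ≠ 1) :
    A.card * (A.card - 1) / 2 + ((A.erase 0).filter fun a => 2 * a = 0 ∨ (2 * a) ^ d = 1).card ≤ d := by
  obtain ⟨b₀, hb₀, hbad⟩ := hbad
  have hb₀0 : b₀ ≠ 0 := fun h => hbad.1 (by rw [h, mul_zero])
  set A' := A.erase 0 with hA'
  have hb₀' : b₀ ∈ A' := mem_erase.mpr ⟨hb₀0, hb₀⟩
  have hcardA : A'.card + 1 = A.card := by rw [hA']; exact card_erase_add_one h0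
  -- `|A'| = 2m + 1`
  obtain ⟨r, hr⟩ := heven
  have hpos : 0 < A'.card := Finset.card_pos.mpr ⟨b₀, hb₀'⟩
  obtain ⟨m, hm⟩ : ∃ m, 2 * m + 1 = A'.card := ⟨r - 1, by omega⟩
  have hd1 : 1 ≤ d := by
    rcases Nat.eq_zero_or_pos d with h | h
    · exact absurd (by rw [h, pow_zero]) hbad.2
    · exact h
  -- the restricted-clique data of `A'`
  have hA'' : ∀ a ∈ A', ∀ a' ∈ A', a ≠ a' → (a + a') ^ d = 1 :=
    fun a ha a' ha' h => hA a (mem_of_mem_erase ha) a' (mem_of_mem_erase ha') h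
  have hpow : ∀ a ∈ A', a ^ d = 1 := by
    intro a ha
    rw [hA', mem_erase] at ha
    have := hA 0 h0 a ha.2 (Ne.symm ha.1)
    rwa [zero_add] at this
  have hchoose : A.card * (A.card - 1) / 2 = (m + 1) * (2 * m + 1) := by
    rw [← hcardA, ← hm, show 2 * m + 1 + 1 - 1 = 2 * m + 1 by omega,
      show (2 * m + 1 + 1) * (2 * m + 1) = (m + 1) * (2 * m + 1) * 2 by ring, Nat.mul_div_cancel _ two_pos]
  rcases Nat.eq_zero_or_pos m with hm0 | hm1
  · -- `A' = {b₀}`: the good count vanishes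
    subst hm0
    have hA1 : A'.card = 1 := by omega
    obtain ⟨x, hx⟩ := Finset.card_eq_one.mp hA1
    have hxb : x = b₀ := by rw [hx, mem_singleton] at hb₀'; exact hb₀'.symm
    subst hxb
    have hfilter : (A'.filter fun a => 2 * a = 0 ∨ (2 * a) ^ d = 1) = ∅ := by
      rw [hx, Finset.filter_singleton, if_neg (not_or.mpr ⟨hbad.1, hbad.2⟩)]
    rw [hchoose, hfilter, card_empty]
    omega
  · set f : F[X] := ((∑ a ∈ A', C (Lagrange.nodalWeight A' id a) * ((X + C a) ^ (d + m) * (X - C a) ^ m)) -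
      C ((-1 : F) ^ m)) with hf
    have hdeg : f.natDegree ≤ d := natDegree_stepanovPoly_le A' d m hm
    have hf0 : f ≠ 0 :=
      stepanovPoly_ne_zero A' d m hm hm1 b₀ hb₀' hbad fun a ha hab => hA'' a ha b₀ hb₀' hab
    -- multiplicities: `m + [good]` on `A'`, and `2m + 1` at `0`
    set mult : F → ℕ := fun b =>
      if b = 0 then 2 * m + 1 else if 2 * b = 0 ∨ (2 * b) ^ d = 1 then m + 1 else m with hmult
    have hroot : ∀ b ∈ A, (X - C b) ^ mult b ∣ f := by
      intro b hb
      by_cases hb0 : b = 0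
      · subst hb0
        have h := X_pow_dvd_stepanovPoly A' d m hm hpow
        simp only [hmult, if_true, map_zero, sub_zero]
        exact h
      · have hb' : b ∈ A' := mem_erase.mpr ⟨hb0, hb⟩
        have h := X_sub_C_pow_dvd_stepanovPoly A' d m hm hm1 b fun a ha hab => hA'' a ha b hb' hab
        simp only [hmult, if_neg hb0]
        exact h
    have hprod : (∏ b ∈ A, (X - C b) ^ mult b) ∣ f := by
      refine Finset.prod_dvd_of_coprime ?_ hroot
      intro b _ b' _ hbb'
      exact (pairwise_coprime_X_sub_C (K := F) Function.injective_id hbb').pow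
    have hsum : ∑ b ∈ A, mult b ≤ d := by
      have h1 : (∏ b ∈ A, (X - C b) ^ mult b).natDegree = ∑ b ∈ A, mult b := by
        rw [natDegree_prod_of_monic _ _ fun b _ => (monic_X_sub_C b).pow (mult b)]
        refine Finset.sum_congr rfl fun b _ => ?_
        rw [(monic_X_sub_C b).natDegree_pow, natDegree_X_sub_C, mul_one]
      rw [← h1]
      exact (natDegree_le_of_dvd hprod hf0).trans hdeg
    -- bookkeeping: `Σ_{b ∈ A} mult b = (2m+1) + m |A'| + #good(A') = (m+1)(2m+1) + #good(A')`
    have hsplit : ∑ b ∈ A, mult b = mult 0 + ∑ b ∈ A', mult b := by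
      rw [hA', ← Finset.add_sum_erase A mult h0]
    have hbook : ∑ b ∈ A', mult b = m * A'.card + (A'.filter fun a => 2 * a = 0 ∨ (2 * a) ^ d = 1).card := by
      rw [Finset.card_filter, Finset.card_eq_sum_ones A', Finset.mul_sum, ← Finset.sum_add_distrib]
      refine Finset.sum_congr rfl fun b hb => ?_
      have hb0 : b ≠ 0 := (mem_erase.mp hb).1
      simp only [hmult, if_neg hb0, mul_one]
      split_ifs <;> omega
    have hmult0 : mult 0 = 2 * m + 1 := by simp only [hmult, if_true]
    rw [hsplit, hmult0, hbook, ← hm] at hsum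
    rw [hchoose]
    have : (m + 1) * (2 * m + 1) = 2 * m + 1 + m * (2 * m + 1) := by ring
    rw [this, add_assoc]
    exact hsum

end ZeroRefinement

end Literature.Combinatorics.Additive.Yip
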